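import Literature.NumberTheory.Automorphic.LocalOrbitalIntegral   -- ★ `classOrbitalIntegral`, `OrbitalMeasureFamily`
import Mathlib.LinearAlgebra.Matrix.NonsingularInverse
import HarnessLib

/-!
# Reference pieces with an invertible table of orbital integrals SPAN the orbital integrals on `S`
(road «S3-tree», route (A) «SHALIKA»: the glue RANK ⇒ `hspan`; Rogawski 1990 §8.1)

Topic `NumberTheory/Automorphic`; namespace `Literature.NumberTheory.Automorphic`.  THEOREMS ONLY (no definition, no
instance, no notation, no named fact, no `sorry`).  Cell `pub/hodgecm-mathlib` (D-0151), crux H413 = `stmt-HodgeConjecture-24833`,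
road «S3-tree», architect A-p16 (g30).  HONEST LABEL: HC_CM is proved only modulo the printed citations (the 2 remaining named
inputs hLiu418, h413) until rung 0 closes; this file is finite linear algebra and asserts nothing about `U(3)`.

THE POINT.  The RANK organ ★ `det_classOrbitalIntegral_indicator_ne_zero` (`OrbitalIntegralIndicatorSeparation`) delivers, for a
finite set `S` of conjugacy classes and reference pieces `g_{u′}` (`u′ ∈ S`), an invertible table
`M u u′ := Φ_{mU}(u, g_{u′})`, `det M ≠ 0`.  The germ fold ★ `localTransferAtOne_of_germExpansion` (`Rogawski1990/LocalTransferAtOneOfGermExpansion`)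
consumes the SPANNING consequence `hspan : ∃ b, ∀ u ∈ S, Φ_{mU}(u, f) = Σ_i b_i · Φ_{mU}(u, g_i)` for every test function `f`.  This
file is the one-line bridge: an invertible square matrix over a field has surjective `mulVec`
(Mathlib `Matrix.mulVec_surjective_iff_isUnit`, `Matrix.isUnit_iff_isUnit_det`), read in the orbital-integral tokens of both files
[Rogawski1990, §8.1 Prop. 8.1.2 p. 114: near the identity a function is determined, for transfer, by its unipotent orbital integrals].

* `exists_forall_eq_sum_mul_of_det_ne_zero` — `det M ≠ 0 ⇒ ∀ v, ∃ b, ∀ u, v u = Σ_i b_i · M u i` (any field);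
* `exists_forall_classOrbitalIntegral_eq_sum_mul_of_det_ne_zero` — the same with `M u u′ = Φ_{mU}(u, g_{u′})`, `u, u′ ∈ S`, in the
  `∀ u ∈ S` form of the germ fold's `hspan` (`ι := ↥S`).

## References
* [Rogawski1990] J. D. Rogawski, *Automorphic Representations of Unitary Groups in Three Variables*, Ann. of Math. Stud. 123 (1990),
  §8.1 Props. 8.1.1–8.1.2 pp. 112–114.
-/

set_option autoImplicit false

noncomputable section

open Matrix

namespace Literature.NumberTheory.Automorphic

/-- **An invertible square matrix over a field spans every vector by its columns, coordinatewise:** if `det M ≠ 0` then for every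
`v` there is `b` with `v u = Σ_i b_i · M u i` for all `u` (`b := M⁻¹ v`; Mathlib `mulVec_surjective_iff_isUnit`).
[cite: Rogawski1990, §8.1 Prop. 8.1.2 p. 114] -/
theorem exists_forall_eq_sum_mul_of_det_ne_zero {K : Type*} [Field K] {n : Type*} [Fintype n] [DecidableEq n]
    (M : Matrix n n K) (hM : M.det ≠ 0) (v : n → K) :
    ∃ b : n → K, ∀ u, v u = ∑ i, b i * M u i := by
  have hunit : IsUnit M := (Matrix.isUnit_iff_isUnit_det M).2 (isUnit_iff_ne_zero.2 hM)
  obtain ⟨b, hb⟩ := (Matrix.mulVec_surjective_iff_isUnit.2 hunit) v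
  refine ⟨b, fun u => ?_⟩
  have hbu := congrFun hb u
  rw [Matrix.mulVec, dotProduct] at hbu
  rw [← hbu]
  exact Finset.sum_congr rfl fun i _ => mul_comm _ _

variable {G : Type*} [Group G] [∀ γ : G, MeasurableSpace (G ⧸ Subgroup.centralizer ({γ} : Set G))]

open scoped Classical in
/-- **RANK ⇒ `hspan`.**  If the reference pieces `g_{u′}` (`u′ ∈ S`) have an invertible table of `S`-orbital integrals,
`det (Φ_{mU}(u, g_{u′}))_{u,u′ ∈ S} ≠ 0` (the conclusion shape of ★ `det_classOrbitalIntegral_indicator_ne_zero`), then the `S`-orbital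
integrals of EVERY `f : G → ℂ` are a combination of theirs: `∃ b, ∀ u ∈ S, Φ_{mU}(u, f) = Σ_i b_i · Φ_{mU}(u, g_i)` — the `hspan` input of
★ `localTransferAtOne_of_germExpansion` with `ι := ↥S`. [cite: Rogawski1990, §8.1 Prop. 8.1.2 p. 114] -/
theorem exists_forall_classOrbitalIntegral_eq_sum_mul_of_det_ne_zero (S : Finset (ConjClasses G)) (mU : OrbitalMeasureFamily G)
    (gref : ↥S → G → ℂ)
    (hdet : (Matrix.of fun u u' : ↥S => classOrbitalIntegral mU (gref u') u).det ≠ 0) (f : G → ℂ) :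
    ∃ b : ↥S → ℂ, ∀ u ∈ S, classOrbitalIntegral mU f u = ∑ i, b i * classOrbitalIntegral mU (gref i) u := by
  obtain ⟨b, hb⟩ := exists_forall_eq_sum_mul_of_det_ne_zero _ hdet fun u : ↥S => classOrbitalIntegral mU f u
  refine ⟨b, fun u hu => ?_⟩
  have h := hb ⟨u, hu⟩
  simpa only [Matrix.of_apply] using h

end Literature.NumberTheory.Automorphic

end
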